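import Literature.MathematicalPhysics.QuantumFieldTheory.Balaban1983to89.B9Eq346GradGpDivTorusL2
import Literature.MathematicalPhysics.QuantumFieldTheory.Balaban1983to89.B9Thm31SiteGradGpDivDecayPar

/-!
# `Balaban1983to89.B9Eq346GradGpDivTorusL2Par` — T. Bałaban, *Propagators for lattice gauge theories in a background field*, Commun. Math. Phys. **99** (1985) 389–434
# [Balaban1985BackgroundPropagators] Thm 3.1 (3.46) p. 398, THE ORDER-ZERO ENTRY `‖h∇_UG′(U)∇*_Uλ‖ ≤ B₀·e^{−δ₀d(y,y′)}‖h‖‖λ‖`, by S. Agmon's method [Agmon1982]: ★★ **THE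
# BLOCK-TO-BLOCK `L²` DECAY OF `D_U G′(U; par) D*_U` AT A GENERIC SITE TRANSPORTER FROM THE THREE TRANSPORTER LAWS** — n06-d's `B9Eq346GradGpDivTorusL2` §2–§3 re-pressed
# over `par` (link 5 of the CASCADE-K re-press of the (3.46)₄ chain; links 1–4 = `B9Thm31Site{GpDecay,AgmonWeight,GpGradDecay,GradGpDivDecay}Par`)

statement-level skeleton of published theorems with citation tags; proofs where landed; nothing here is a claim about the Yang–Mills mass gap

WHY THIS FILE.  `B9Eq346GradGpDivTorusL2` reads w1's `L²`-local estimate for `∇_UG′(U; parSymY)∇\*_U` at dag-n06-j's shifted multi-scale exponent (§1, transporter-free —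
reused BY NAME) and pushes it to def-Y's bond letters (§3).  THIS FILE: the same two steps at ANY site transporter `par` with `G`-valued inverse-symmetric legs at `U` and a
level-weighted coercivity constant `κ₀ ∈ (0, 1∕8]` for `Δ′_a(U; par)`, at an Agmon rate `δ` with `0 ≤ δ ≤ 1`, `δ(d+1) ≤ 1`, `δ²(2(d+1) + (d+1)²) ≤ κ₀∕2`:
★ `hs_restrict_cdS_GpY_cdsS_le_distT_par` (`Σ_{z∈A}Σ_ν HS((∇_νG′(U; par)∇\*_μλ)(z)) ≤ 10·‖λ‖²₁∕(e^{δ((n−1)∕(2L) − 1)})²`), ★ `gradY_GpY_divY_apply_par` (the bond letter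
evaluated), ★★ `hs_block_gradY_GpY_divY_le_par` (`Σ_{f : y(f)=t} HS((D_UG′(U; par)D\*_UA)(f)) ≤ c_f⁴·10(d+1)·(e^{δ((d_T(t,s)−1)∕(2L) − 1)})⁻²·Σ_f HS(A f)`).  Proofs: the originals,
verbatim up to the transporter and the rate (the original is `par := parSymY`, `κ₀ := 1∕8`, `δ := 1∕(4(d+2))`; here `δ` is a parameter — e.g. `δ := κ₀∕(d+2)` is admissible
for every `κ₀ ≤ 1∕2`).
HONEST SCOPE.  One finite lattice operator at a time, laws displayed; NOT a node discharge; count-neutral; nothing continuum ∕ OS ∕ mass gap ∕ Clay.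
Cell `pub-ymgap` (D-0062), Track A node N06 [B9], seat `pub-ymgap-dag-n06-l` (g37), 2026-08-30; NEW file; nothing landed is modified.
-/

noncomputable section

namespace Literature.MathematicalPhysics.QuantumFieldTheory.Balaban1983to89.B9Eq346GradGpDivTorusL2Par

open Literature.MathematicalPhysics.QuantumFieldTheory.Balaban1983to89
open Node00 B6KLevelCensusIndexV1 B6Geom246MultiLevelBox B6MultiLevelBoxOperator B6MultiLevelTorusOperator B6GlobalChartV1 B9BackgroundsKLevelV1
  B9Eq39Adjoint B9Thm311ReadingCoords B9Thm31SiteGradGpDivDecayReg335Y B9Thm31SiteAgmonExponentY B6Geom246MultiLevelTorus B6AgmonExponentMultiLevelTorus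
  B9Eq346GradGpDivTorusL2 B9Thm31SiteGradGpDivDecayPar
open Literature.MathematicalPhysics.QuantumFieldTheory.Balaban1983to89.B9Ineq369CurvatureSmallAtLettersY (hs_nonneg hs_smul trIP_one_self_eq)
open Literature.MathematicalPhysics.QuantumFieldTheory.Balaban1983to89.B9Ineq349SiteComposite (cdSL cdsSL cdSL_apply cdsSL_apply)
open Literature.MathematicalPhysics.QuantumFieldTheory.Balaban1983to89.Node00.OpsYNablaBridge (chartY bondCompY bondCompY_apply gradY_apply_eq_cdS
  divY_eq_sum_cdsSL_comp sum_bond_eq cdS_apply cdsS_apply shiftY_chartY)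
open scoped Matrix Matrix.Norms.L2Operator

variable {d ℓ : ℕ} {hd : 1 ≤ d + 1} {hL : Odd (ℓ + 1) ∧ 1 < ℓ + 1} {b₀ b₁ : ℝ}
variable (i : KIdx d ℓ hd hL b₀ b₁) {N : ℕ} {G : Subgroup (Matrix (Fin N) (Fin N) ℂ)ˣ} (par : SiteParY (Matrix (Fin N) (Fin N) ℂ) i)

/-! ## §2 (3.46)₄ in the direction letters at a generic transporter, with print's rate in the block distance -/

section Site

/-- ★ **(3.46)₄ AT THE SHIFTED MULTI-SCALE EXPONENT, GENERIC TRANSPORTER**: `G ≤ U(N)`, `N ≥ 1`; `U` `G`-valued, legs `par U z w ∈ G` inverse-symmetric, coercivity `κ₀ ∈ (0, 1∕8]`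
of `Δ′_a(U; par)`; a rate `δ` (`0 ≤ δ ≤ 1`, `δ(d+1) ≤ 1`, `δ²(2(d+1) + (d+1)²) ≤ κ₀∕2`); a source block `s` carrying `λ`, a finite set `A` of sites in blocks at block distance `≥ n`
from `s`.  THEN, for every direction `μ`, `Σ_{z∈A}Σ_ν HS((∇_{U,ν}G′(U; par)∇\*_{U,μ}λ)(z)) ≤ 10·‖λ‖²₁ ∕ (e^{δ((n−1)∕(2L) − 1)})²`.
[cite: Balaban1985BackgroundPropagators, Thm 3.1 (3.46)–(3.47) p.398, p.397 (weighted distance); Balaban1984PropagatorsII, (2.46) p.231; Agmon1982, Ch.1, Thm 1.5] -/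
theorem hs_restrict_cdS_GpY_cdsS_le_distT_par [Nonempty (Fin N)] (hG : G ≤ B7Prop2Explicit.unitaryUnits (Matrix (Fin N) (Fin N) ℂ))
    {U : CfgY (Matrix (Fin N) (Fin N) ℂ) i} (hU : ∀ μ x, U μ x ∈ G) (hpar : ∀ z w : SiteY i, par U z w ∈ G)
    (hinv : ∀ z z' : SiteY i, par U z z' = (par U z' z)⁻¹) {κ₀ : ℝ} (hκ₀ : 0 < κ₀) (hκ₀1 : κ₀ ≤ 1 / 8)
    (hcoer : ∀ Φ : SiteY i → Matrix (Fin N) (Fin N) ℂ,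
      κ₀ * ∑ z : SiteY i, (((((ℓ + 1) ^ (blkOf i.D.toDomains z).1.1 : ℕ) : ℝ)) ^ 2)⁻¹ * ∑ a, ∑ b, ‖Φ z a b‖ ^ 2 ≤ trIP (fun _ => (1 : ℝ)) Φ (deltaPrimeAY i par U Φ))
    {δ : ℝ} (hδ0 : 0 ≤ δ) (hδ1 : δ ≤ 1) (hδD : δ * ((d : ℝ) + 1) ≤ 1) (hδκ : δ ^ 2 * (2 * ((d : ℝ) + 1) + ((d : ℝ) + 1) ^ 2) ≤ κ₀ / 2)
    (μ : Fin (d + 1)) (s : BlkY i) {A : Finset (SiteY i)} {Λ : SiteY i → Matrix (Fin N) (Fin N) ℂ} (hΛ : ∀ z, blkOf i.D.toDomains z ≠ s → Λ z = 0)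
    {n : ℕ} (hA : ∀ z ∈ A, n ≤ (bondT i.D).dist (blkOf i.D.toDomains z) s) :
    ∑ z ∈ A, ∑ ν : Fin (d + 1), ∑ a, ∑ b, ‖cdS i U ν (GpY i par U (cdsS i U μ Λ)) z a b‖ ^ 2
      ≤ 10 * trIP (fun _ => (1 : ℝ)) Λ Λ / Real.exp (δ * (((((n : ℝ)) - 1) / (2 * ((ℓ + 1 : ℕ) : ℝ)) - 1))) ^ 2 := by
  classical
  set B : Finset (SiteY i) := Finset.univ.filter (fun z => blkOf i.D.toDomains z = s ∨ blkOf i.D.toDomains ((shiftY i μ).symm z) = s) with hB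
  have hv : ∀ z, z ∉ B → cdsS i U μ Λ z = 0 := by
    intro z hz
    rw [hB, Finset.mem_filter, not_and] at hz
    have hz' := hz (Finset.mem_univ z)
    rw [not_or] at hz'
    rw [cdsS_apply, hΛ _ hz'.2, hΛ _ hz'.1, R_zero, sub_zero]
  have hρB : ∀ z ∈ B, max (msRhoT i.D s z - 1) 0 = 0 := by
    intro z hz
    rw [hB, Finset.mem_filter] at hz
    rcases hz.2 with h | h
    · exact msRhoYPos_eq_zero i h
    · have e : z = shiftY i μ ((shiftY i μ).symm z) := ((shiftY i μ).apply_symm_apply z).symm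
      rw [e]
      exact msRhoYPos_eq_zero_shift i μ h
  exact hs_restrict_cdS_GpY_cdsS_le_exp_par i par hG hU hpar hinv hκ₀ hκ₀1 hcoer hδ0 hδ1 hδD hδκ (ρ := fun z => max (msRhoT i.D s z - 1) 0)
    (msRhoYPos_bond i s) (msRhoYPos_bond' i s) (msRhoYPos_block i s) μ hv hρB (msRhoYPos_ge_of_le i s hA)

end Site

/-! ## §3 The bond-letter form at a generic transporter -/

section Bond

/-- ★ the letter `D_U G′(U; par) D\*_U` evaluated at a bond: `(D_UG′D\*_UA)(⟨x, ν⟩) = c_f² · Σ_μ (∇_{U,ν}G′(U; par)∇\*_{U,μ}A_μ)(chart x)`.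
[cite: Balaban1985BackgroundPropagators, (3.3) p.390–391, (3.8) p.392, (3.46) p.398] -/
theorem gradY_GpY_divY_apply_par (U : CfgY (Matrix (Fin N) (Fin N) ℂ) i) (A : FBondY i → Matrix (Fin N) (Fin N) ℂ) (f : FBondY i) :
    (gradY i U ∘ₗ GpY i par U ∘ₗ divY i U) A f =
      (((i.cf ^ 2 : ℝ)) : ℂ) • ∑ μ : Fin (d + 1), cdS i U f.dir (GpY i par U (cdsS i U μ (bondCompY i μ A))) (chartY i f.src) := by
  rw [LinearMap.comp_apply, LinearMap.comp_apply, gradY_apply_eq_cdS, divY_eq_sum_cdsSL_comp]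
  rw [LinearMap.smul_apply, map_smul, ← cdSL_apply, map_smul, LinearMap.coe_sum, Finset.sum_apply, map_sum, map_sum]
  rw [Pi.smul_apply, Finset.sum_apply, smul_smul, ← Complex.ofReal_mul, ← pow_two]
  congr 1

/-- ★★ **(3.46)₄ FOR THE BOND LETTER `D_U G′(U; par) D\*_U` BETWEEN TORUS BLOCKS** (laws and rate as in `hs_restrict_cdS_GpY_cdsS_le_distT_par`): for `A : bonds → M_N(ℂ)`
vanishing off the fine bonds of the block `s` and every block `t`,
`Σ_{f : y(f) = t} HS((D_UG′(U; par)D\*_UA)(f)) ≤ c_f⁴·10(d+1)·(e^{δ((d_T(t,s)−1)∕(2L) − 1)})⁻²·Σ_f HS(A(f))`.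
[cite: Balaban1985BackgroundPropagators, Thm 3.1 (3.46)–(3.47) p.398, (3.3) p.390, (3.8) p.392; Balaban1984PropagatorsII, (2.46) p.231, (2.54) p.233; Agmon1982, Ch.1, Thm 1.5] -/
theorem hs_block_gradY_GpY_divY_le_par [Nonempty (Fin N)] (hG : G ≤ B7Prop2Explicit.unitaryUnits (Matrix (Fin N) (Fin N) ℂ))
    {U : CfgY (Matrix (Fin N) (Fin N) ℂ) i} (hU : ∀ μ x, U μ x ∈ G) (hpar : ∀ z w : SiteY i, par U z w ∈ G)
    (hinv : ∀ z z' : SiteY i, par U z z' = (par U z' z)⁻¹) {κ₀ : ℝ} (hκ₀ : 0 < κ₀) (hκ₀1 : κ₀ ≤ 1 / 8)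
    (hcoer : ∀ Φ : SiteY i → Matrix (Fin N) (Fin N) ℂ,
      κ₀ * ∑ z : SiteY i, (((((ℓ + 1) ^ (blkOf i.D.toDomains z).1.1 : ℕ) : ℝ)) ^ 2)⁻¹ * ∑ a, ∑ b, ‖Φ z a b‖ ^ 2 ≤ trIP (fun _ => (1 : ℝ)) Φ (deltaPrimeAY i par U Φ))
    {δ : ℝ} (hδ0 : 0 ≤ δ) (hδ1 : δ ≤ 1) (hδD : δ * ((d : ℝ) + 1) ≤ 1) (hδκ : δ ^ 2 * (2 * ((d : ℝ) + 1) + ((d : ℝ) + 1) ^ 2) ≤ κ₀ / 2)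
    (s t : BlkY i) {A : FBondY i → Matrix (Fin N) (Fin N) ℂ} (hA : ∀ f, blkV1 i.hN i.D f ≠ s → A f = 0) :
    ∑ f : FBondY i, (if blkV1 i.hN i.D f = t then (∑ a, ∑ b, ‖(gradY i U ∘ₗ GpY i par U ∘ₗ divY i U) A f a b‖ ^ 2) else 0)
      ≤ i.cf ^ 4 * (10 * ((d : ℝ) + 1))
          / Real.exp (δ * (((((bondT i.D).dist t s : ℝ)) - 1) / (2 * ((ℓ + 1 : ℕ) : ℝ)) - 1)) ^ 2
        * ∑ f : FBondY i, ∑ a, ∑ b, ‖A f a b‖ ^ 2 := by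
  classical
  set T := gradY i U ∘ₗ GpY i par U ∘ₗ divY i U with hT
  set E : ℝ := Real.exp (δ * (((((bondT i.D).dist t s : ℝ)) - 1) / (2 * ((ℓ + 1 : ℕ) : ℝ)) - 1)) with hE
  have hE0 : 0 < E := Real.exp_pos _
  have hAμ : ∀ (μ : Fin (d + 1)) (w : SiteY i), blkOf i.D.toDomains w ≠ s → bondCompY i μ A w = 0 := by
    intro μ w hw
    rw [bondCompY_apply]
    exact hA _ (by rw [blkV1_mk_chartY_symm]; exact hw)
  set At : Finset (SiteY i) := Finset.univ.filter (fun z => blkOf i.D.toDomains z = t) with hAt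
  have hAt' : ∀ z ∈ At, (bondT i.D).dist t s ≤ (bondT i.D).dist (blkOf i.D.toDomains z) s := by
    intro z hz
    rw [hAt, Finset.mem_filter] at hz
    rw [hz.2]
  have hcomp : ∀ μ : Fin (d + 1), ∑ z ∈ At, ∑ ν : Fin (d + 1), ∑ a, ∑ b, ‖cdS i U ν (GpY i par U (cdsS i U μ (bondCompY i μ A))) z a b‖ ^ 2
      ≤ 10 * trIP (fun _ => (1 : ℝ)) (bondCompY i μ A) (bondCompY i μ A) / E ^ 2 :=
    fun μ => hs_restrict_cdS_GpY_cdsS_le_distT_par i par hG hU hpar hinv hκ₀ hκ₀1 hcoer hδ0 hδ1 hδD hδκ μ s (hAμ μ) hAt'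
  have hLHS : ∑ f : FBondY i, (if blkV1 i.hN i.D f = t then (∑ a, ∑ b, ‖T A f a b‖ ^ 2) else 0)
      = ∑ z ∈ At, ∑ ν : Fin (d + 1), ∑ a, ∑ b, ‖T A ⟨(chartY i).symm z, ν⟩ a b‖ ^ 2 := by
    rw [sum_bond_eq, ← Equiv.sum_comp (chartY i).symm]
    rw [hAt, Finset.sum_filter]
    refine Finset.sum_congr rfl fun z _ => ?_
    simp only [blkV1_mk_chartY_symm]
    split_ifs with h
    · rfl
    · simp
  have hval : ∀ (z : SiteY i) (ν : Fin (d + 1)), ∑ a, ∑ b, ‖T A ⟨(chartY i).symm z, ν⟩ a b‖ ^ 2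
      ≤ i.cf ^ 4 * (((d : ℝ) + 1) * ∑ μ : Fin (d + 1), ∑ a, ∑ b, ‖cdS i U ν (GpY i par U (cdsS i U μ (bondCompY i μ A))) z a b‖ ^ 2) := by
    intro z ν
    rw [hT, gradY_GpY_divY_apply_par, hs_smul, Complex.norm_real, Real.norm_eq_abs, sq_abs, Equiv.apply_symm_apply]
    rw [show (i.cf ^ 2) ^ 2 = i.cf ^ 4 by ring]
    exact mul_le_mul_of_nonneg_left (hs_sum_fin_le _) (by positivity)
  have hRHS : ∑ μ : Fin (d + 1), trIP (fun _ => (1 : ℝ)) (bondCompY i μ A) (bondCompY i μ A) = ∑ f : FBondY i, ∑ a, ∑ b, ‖A f a b‖ ^ 2 := by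
    rw [sum_bond_eq, ← Equiv.sum_comp (chartY i).symm, Finset.sum_comm]
    refine Finset.sum_congr rfl fun μ _ => ?_
    rw [trIP_one_self_eq]
    refine Finset.sum_congr rfl fun z _ => ?_
    rw [bondCompY_apply]
  have hS0 : 0 ≤ ∑ f : FBondY i, ∑ a, ∑ b, ‖A f a b‖ ^ 2 := Finset.sum_nonneg fun f _ => hs_nonneg _
  rw [hLHS]
  calc ∑ z ∈ At, ∑ ν : Fin (d + 1), ∑ a, ∑ b, ‖T A ⟨(chartY i).symm z, ν⟩ a b‖ ^ 2
      ≤ ∑ z ∈ At, ∑ ν : Fin (d + 1), i.cf ^ 4 * (((d : ℝ) + 1) *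
          ∑ μ : Fin (d + 1), ∑ a, ∑ b, ‖cdS i U ν (GpY i par U (cdsS i U μ (bondCompY i μ A))) z a b‖ ^ 2) :=
        Finset.sum_le_sum fun z _ => Finset.sum_le_sum fun ν _ => hval z ν
    _ = i.cf ^ 4 * (((d : ℝ) + 1) * ∑ μ : Fin (d + 1),
          ∑ z ∈ At, ∑ ν : Fin (d + 1), ∑ a, ∑ b, ‖cdS i U ν (GpY i par U (cdsS i U μ (bondCompY i μ A))) z a b‖ ^ 2) := by
        have hcomm : ∑ μ : Fin (d + 1), ∑ z ∈ At, ∑ ν : Fin (d + 1), ∑ a, ∑ b, ‖cdS i U ν (GpY i par U (cdsS i U μ (bondCompY i μ A))) z a b‖ ^ 2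
            = ∑ z ∈ At, ∑ ν : Fin (d + 1), ∑ μ : Fin (d + 1), ∑ a, ∑ b, ‖cdS i U ν (GpY i par U (cdsS i U μ (bondCompY i μ A))) z a b‖ ^ 2 := by
          rw [Finset.sum_comm]
          exact Finset.sum_congr rfl fun z _ => Finset.sum_comm
        rw [hcomm]
        simp only [Finset.mul_sum]
    _ ≤ i.cf ^ 4 * (((d : ℝ) + 1) * ∑ μ : Fin (d + 1), 10 * trIP (fun _ => (1 : ℝ)) (bondCompY i μ A) (bondCompY i μ A) / E ^ 2) :=
        mul_le_mul_of_nonneg_left (mul_le_mul_of_nonneg_left (Finset.sum_le_sum fun μ _ => hcomp μ) (by positivity)) (by positivity)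
    _ = i.cf ^ 4 * (10 * ((d : ℝ) + 1)) / E ^ 2 * ∑ f : FBondY i, ∑ a, ∑ b, ‖A f a b‖ ^ 2 := by
        rw [← hRHS]
        simp only [Finset.mul_sum]
        exact Finset.sum_congr rfl fun μ _ => by ring

end Bond

end Literature.MathematicalPhysics.QuantumFieldTheory.Balaban1983to89.B9Eq346GradGpDivTorusL2Par

end
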